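import Mathlib
import Literature.Probability.Percolation.SiteInterfaceStructure
import Literature.Probability.LatticeModels.TriangularLatticeProofs
import HarnessLib

/-!
# Stub `stub_cft1` (S2a) of line `Sketch`, crux `LoopLimitZ2EqT` (stmt-CriticalPhenomena-4833):
# local combinatorics of the fine interface of the blow-up

Helper file (`--supports stmt-CriticalPhenomena-4833`), first part of the combinatorial
fellow-travelling (CFT1): the **local dictionary** between one step of a coarse interface loop of
a cell set `τ` (site configuration on `𝕋`) and the corresponding steps of the interface of the
blow-up `β τ = {v | (∀ j, 2 ∣ v j) ∨ ⌊v/2⌋ ∈ τ}` on the half-mesh lattice, phrased through the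
interface successor map (`IsExitSide`, `ifaceSucc`, `SiteInterfaceStructure.lean`). Nothing here
depends on the type of the loops; the same lemmas serve the type-`0` twin (CFT0).

Geometry. The open cell `x ∈ τ` blows up to the six lattice points of the closed up-triangle
`T(x)` with corners `2x, 2x + 2e₀, 2x + 2e₁` (its corners are open anyway, its three edge
midpoints `2x + e₀, 2x + e₁, 2x + e₀ + e₁` are open iff `x ∈ τ`). A coarse up face `(w, 0)`
corresponds to the big down-triangle `D(w)` between `T(w), T(w + e₀), T(w + e₁)`, whose middle
fine face is `mid (w, 0) = (2w + (1,1), 0)`, with vertices the three midpoints, coloured like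
`w, w + e₀, w + e₁` (`cft_mid_faceVertex_mem_iff`); a coarse down face `(u, 1)` corresponds to
the corner `c = 2u + (2,2)` shared by `T(u + e₀), T(u + e₀ + e₁), T(u + e₁)`, and for a vertex
`a` of `(u, 1)` the fine up face `(a + u + (1,1), 0)` is the corner face of `T(a)` at `c`.

* `cft_faceVertex_apply`, `cft_oppFace_fst_apply`, `cft_oppFace_snd` — coordinates of the
  anticlockwise vertices and of the opposite faces of a face;
* `cft_mem_blowup_iff_of_coords`, `cft_mem_blowup_of_even` — membership in the blow-up;
* `cft_up_exit`, `cft_up_corner_exit`, `cft_up_chain` — the two fine steps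
  `mid → corner face of D(w) → corner face of T(r)` shadowing a coarse step out of an up face
  across a side with closed first vertex `r`;
* `cft_down_exit`, `cft_down_short_exit`, `cft_down_long_exit`, `cft_down_short_chain`,
  `cft_down_long_chain` — the fine steps around the corner `c` of a down face: out of the corner
  face of `T(a)` (`a` its `k`-th vertex, closed) into the corner face of the next `D`, then either
  into the middle face of that `D` (vertex `k + 1` open: two fine steps shadow the coarse step
  across the side `k + 2`) or on around `c` through the corner face of `T` of the closed vertex
  `k + 1` (four fine steps shadow the coarse step across the side `k`).
-/

noncomputable section

open Set

namespace Summit.CriticalPhenomena.CardyFormulaZ2.Cruxes.LoopLimitZ2EqT.HexSegment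

open Literature.Probability.Percolation Literature.Probability.LatticeModels

/-! ### Coordinates of face vertices and opposite faces -/

/-- Coordinates of the anticlockwise vertices of a face: `x, x + e₀, x + e₁` for the up face
`(x, 0)` and `x + e₀, x + e₀ + e₁, x + e₁` for the down face `(x, 1)`. -/
theorem cft_faceVertex_apply (g : HexVertex) (k : Fin 3) (i : Fin 2) :
    faceVertex g k i = g.1 i +
      (![![![0, 0], ![1, 0], ![0, 1]], ![![1, 0], ![1, 1], ![0, 1]]] : Fin 2 → Fin 3 → Fin 2 → ℤ) g.2 k i := by
  obtain ⟨x, a⟩ := g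
  fin_cases a <;> fin_cases k <;> fin_cases i <;> simp [faceVertex]

/-- Coordinates of the cells of the opposite faces: `x, x - e₀, x - e₁` for the up face `(x, 0)`
and `x + e₁, x, x + e₀` for the down face `(x, 1)`. -/
theorem cft_oppFace_fst_apply (g : HexVertex) (k : Fin 3) (i : Fin 2) :
    (oppFace g k).1 i = g.1 i +
      (![![![0, 0], ![-1, 0], ![0, -1]], ![![0, 1], ![0, 0], ![1, 0]]] : Fin 2 → Fin 3 → Fin 2 → ℤ) g.2 k i := by
  obtain ⟨x, a⟩ := g
  fin_cases a <;> fin_cases k <;> fin_cases i <;> simp [oppFace, sub_eq_add_neg]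

/-- The opposite faces of an up face are down faces and conversely. -/
theorem cft_oppFace_snd (g : HexVertex) (k : Fin 3) : (oppFace g k).2 = ![1, 0] g.2 := by
  obtain ⟨x, a⟩ := g
  fin_cases a <;> fin_cases k <;> simp [oppFace]

attribute [local simp] cft_faceVertex_apply cft_oppFace_fst_apply cft_oppFace_snd

/-- A face from its coordinates. -/
theorem cft_face_ext {g : HexVertex} {y : Site 2} {b : Fin 2} (h : g.1 0 = y 0 ∧ g.1 1 = y 1 ∧ g.2 = b) :
    g = (y, b) := by
  obtain ⟨x, a⟩ := g
  obtain ⟨h0, h1, rfl⟩ := h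
  refine Prod.ext (funext fun i => ?_) rfl
  fin_cases i
  · exact h0
  · exact h1

/-! ### Membership in the blow-up in coordinates -/

/-- A doubled vertex (both coordinates even) is open in the blow-up. -/
theorem cft_mem_blowup_of_even {τ : SiteConfig (Site 2)} {v : Site 2} (a b : ℤ)
    (h : v 0 = 2 * a ∧ v 1 = 2 * b) :
    v ∈ {v : Site 2 | (∀ j, (2 : ℤ) ∣ v j) ∨ (fun j => v j / 2) ∈ τ} :=
  Or.inl fun j => by
    fin_cases j
    · exact ⟨a, h.1⟩
    · exact ⟨b, h.2⟩

/-- A non-corner site of the block `2x + {0,1}²` of the cell `x` is open in the blow-up iff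
`x ∈ τ`. -/
theorem cft_mem_blowup_iff_of_coords {τ : SiteConfig (Site 2)} {v : Site 2} (x : Site 2)
    (h : (v 0 = 2 * x 0 ∨ v 0 = 2 * x 0 + 1) ∧ (v 1 = 2 * x 1 ∨ v 1 = 2 * x 1 + 1) ∧
      (v 0 = 2 * x 0 + 1 ∨ v 1 = 2 * x 1 + 1)) :
    v ∈ {v : Site 2 | (∀ j, (2 : ℤ) ∣ v j) ∨ (fun j => v j / 2) ∈ τ} ↔ x ∈ τ := by
  obtain ⟨h0, h1, hodd⟩ := h
  have hne : ¬ ∀ j, (2 : ℤ) ∣ v j := fun he => by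
    obtain ⟨c, hc⟩ := he 0; obtain ⟨d, hd⟩ := he 1; omega
  have hx : (fun j => v j / 2) = x := by
    funext j; fin_cases j
    · show v 0 / 2 = x 0; omega
    · show v 1 / 2 = x 1; omega
  simp only [mem_setOf_eq, hx]
  exact ⟨fun h => h.resolve_left hne, Or.inr⟩

/-! ### Out of an up face: through the middle face of `D(w)` -/

/-- **The vertices of the middle fine face `(2w + (1,1), 0)` of `D(w)` are coloured like the
vertices of the coarse up face `(w, 0)`**: its `k`-th vertex is the midpoint, inside `D(w)`, of
an edge of `T(faceVertex (w,0) k)`. -/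
theorem cft_mid_faceVertex_mem_iff (τ : SiteConfig (Site 2)) {G : HexVertex} (hG : G.2 = 0) (k : Fin 3) :
    faceVertex ((fun j => G.1 j + G.1 j + 1 : Site 2), (0 : Fin 2)) k ∈
        {v : Site 2 | (∀ j, (2 : ℤ) ∣ v j) ∨ (fun j => v j / 2) ∈ τ} ↔
      faceVertex G k ∈ τ := by
  obtain ⟨w, a⟩ := G
  simp only at hG
  subst hG
  refine cft_mem_blowup_iff_of_coords (faceVertex (w, 0) k) ?_
  fin_cases k <;> (simp; omega)

/-- **First fine step out of an up face.** An exit side `J` of the coarse up face `G = (w, 0)`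
is an exit side of the middle fine face of `D(w)`. -/
theorem cft_up_exit {τ : SiteConfig (Site 2)} {G : HexVertex} (hG : G.2 = 0) {J : Fin 3}
    (h : IsExitSide τ G J) :
    IsExitSide {v : Site 2 | (∀ j, (2 : ℤ) ∣ v j) ∨ (fun j => v j / 2) ∈ τ}
      ((fun j => G.1 j + G.1 j + 1 : Site 2), (0 : Fin 2)) J :=
  ⟨fun h' => h.1 ((cft_mid_faceVertex_mem_iff τ hG _).1 h'), (cft_mid_faceVertex_mem_iff τ hG _).2 h.2⟩

/-- **Second fine step out of an up face.** From the corner face of `D(w)` reached across the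
side `J` of `G = (w, 0)` (first vertex `r = faceVertex G (J+1)` closed, second vertex open), the
fine interface leaves across the side `J + 2` into the corner face `(r + u + (1,1), 0)` of
`T(r)` at the corner of the coarse down face `(u, 1) = oppFace G J`. -/
theorem cft_up_corner_exit {τ : SiteConfig (Site 2)} {G : HexVertex} (hG : G.2 = 0) {J : Fin 3}
    (hr : faceVertex G (J + 1) ∉ τ) (hl : faceVertex G (J + 2) ∈ τ) :
    IsExitSide {v : Site 2 | (∀ j, (2 : ℤ) ∣ v j) ∨ (fun j => v j / 2) ∈ τ}
        (oppFace ((fun j => G.1 j + G.1 j + 1 : Site 2), (0 : Fin 2)) J) (J + 2) ∧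
      oppFace (oppFace ((fun j => G.1 j + G.1 j + 1 : Site 2), (0 : Fin 2)) J) (J + 2) =
        ((fun j => faceVertex G (J + 1) j + (oppFace G J).1 j + 1 : Site 2), (0 : Fin 2)) := by
  obtain ⟨w, a⟩ := G
  simp only at hG
  subst hG
  fin_cases J
  · refine ⟨⟨?_, ?_⟩, cft_face_ext (by simp; omega)⟩
    · exact (cft_mem_blowup_iff_of_coords (faceVertex (w, 0) (0 + 1)) (by simp; omega)).not.2 hr
    · exact cft_mem_blowup_of_even (w 0 + 1) (w 1 + 1) (by simp; omega)
  · refine ⟨⟨?_, ?_⟩, cft_face_ext (by simp; omega)⟩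
    · exact (cft_mem_blowup_iff_of_coords (faceVertex (w, 0) (1 + 1)) (by simp; omega)).not.2 hr
    · exact cft_mem_blowup_of_even (w 0) (w 1 + 1) (by simp; omega)
  · refine ⟨⟨?_, ?_⟩, cft_face_ext (by simp; omega)⟩
    · exact (cft_mem_blowup_iff_of_coords (faceVertex (w, 0) (2 + 1)) (by simp; omega)).not.2 hr
    · exact cft_mem_blowup_of_even (w 0 + 1) (w 1) (by simp; omega)

/-- **The two fine steps shadowing a coarse step out of an up face** `G = (w, 0)` across its exit
side `J` (closed vertex `r = faceVertex G (J + 1)`): middle face of `D(w)` → corner face of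
`D(w)` → corner face `(r + u + (1,1), 0)` of `T(r)` at the corner of `(u, 1) = oppFace G J`. -/
theorem cft_up_chain : ∀ {τ : SiteConfig (Site 2)} {G : HexVertex}, G.2 = 0 → ∀ {J : Fin 3}, IsExitSide τ G J → ifaceSucc {v : Site 2 | (∀ j, (2 : ℤ) ∣ v j) ∨ (fun j => v j / 2) ∈ τ} ((fun j => G.1 j + G.1 j + 1 : Site 2), (0 : Fin 2)) = some (oppFace ((fun j => G.1 j + G.1 j + 1 : Site 2), (0 : Fin 2)) J) ∧ ifaceSucc {v : Site 2 | (∀ j, (2 : ℤ) ∣ v j) ∨ (fun j => v j / 2) ∈ τ} (oppFace ((fun j => G.1 j + G.1 j + 1 : Site 2), (0 : Fin 2)) J) = some ((fun j => faceVertex G (J + 1) j + (oppFace G J).1 j + 1 : Site 2), (0 : Fin 2)) := by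
  intro τ G hG J h
  obtain ⟨h1, h2⟩ := cft_up_corner_exit hG h.1 h.2
  exact ⟨ifaceSucc_eq_some (cft_up_exit hG h), by rw [ifaceSucc_eq_some h1, h2]⟩

/-! ### Around the corner of a down face -/

/-- **Out of the corner face of a closed triangle.** For a down face `G = (u, 1)` with closed
`k`-th vertex `a`, the corner face `(a + u + (1,1), 0)` of `T(a)` at the corner `c = 2u + (2,2)`
(its vertices: the open corner `c` and two closed midpoints of `T(a)`) has exit side `k`, into
the corner face at `c` of the big down-triangle following `T(a)` anticlockwise around `c`. -/
theorem cft_down_exit {τ : SiteConfig (Site 2)} {G : HexVertex} (hG : G.2 = 1) {k : Fin 3}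
    (ha : faceVertex G k ∉ τ) :
    IsExitSide {v : Site 2 | (∀ j, (2 : ℤ) ∣ v j) ∨ (fun j => v j / 2) ∈ τ}
      ((fun j => faceVertex G k j + G.1 j + 1 : Site 2), (0 : Fin 2)) k := by
  obtain ⟨u, a⟩ := G
  simp only at hG
  subst hG
  fin_cases k
  · exact ⟨(cft_mem_blowup_iff_of_coords (faceVertex (u, 1) 0) (by simp; omega)).not.2 ha,
      cft_mem_blowup_of_even (u 0 + 1) (u 1 + 1) (by simp; omega)⟩
  · exact ⟨(cft_mem_blowup_iff_of_coords (faceVertex (u, 1) 1) (by simp; omega)).not.2 ha,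
      cft_mem_blowup_of_even (u 0 + 1) (u 1 + 1) (by simp; omega)⟩
  · exact ⟨(cft_mem_blowup_iff_of_coords (faceVertex (u, 1) 2) (by simp; omega)).not.2 ha,
      cft_mem_blowup_of_even (u 0 + 1) (u 1 + 1) (by simp; omega)⟩

/-- **Short turn: into the middle face.** If the `k`-th vertex `a` of the down face `G = (u, 1)`
is closed and the next one `b` (vertex `k + 1`) is open, the corner face at `c` of the big
down-triangle between `T(a)` and `T(b)` (vertices: `c` open, a midpoint of `T(a)` closed, a
midpoint of `T(b)` open) has exit side `k + 2`, into the middle fine face of that down-triangle,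
which is the blow-up of the coarse up face `oppFace G (k + 2)` across the side `{a, b}`. -/
theorem cft_down_short_exit {τ : SiteConfig (Site 2)} {G : HexVertex} (hG : G.2 = 1) {k : Fin 3}
    (ha : faceVertex G k ∉ τ) (hb : faceVertex G (k + 1) ∈ τ) :
    IsExitSide {v : Site 2 | (∀ j, (2 : ℤ) ∣ v j) ∨ (fun j => v j / 2) ∈ τ}
        (oppFace ((fun j => faceVertex G k j + G.1 j + 1 : Site 2), (0 : Fin 2)) k) (k + 2) ∧
      oppFace (oppFace ((fun j => faceVertex G k j + G.1 j + 1 : Site 2), (0 : Fin 2)) k) (k + 2) =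
        ((fun j => (oppFace G (k + 2)).1 j + (oppFace G (k + 2)).1 j + 1 : Site 2), (0 : Fin 2)) := by
  obtain ⟨u, a⟩ := G
  simp only at hG
  subst hG
  fin_cases k
  · refine ⟨⟨?_, ?_⟩, cft_face_ext (by simp; omega)⟩
    · exact (cft_mem_blowup_iff_of_coords (faceVertex (u, 1) 0) (by simp; omega)).not.2 ha
    · exact (cft_mem_blowup_iff_of_coords (faceVertex (u, 1) (0 + 1)) (by simp; omega)).2 hb
  · refine ⟨⟨?_, ?_⟩, cft_face_ext (by simp; omega)⟩
    · exact (cft_mem_blowup_iff_of_coords (faceVertex (u, 1) 1) (by simp; omega)).not.2 ha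
    · exact (cft_mem_blowup_iff_of_coords (faceVertex (u, 1) (1 + 1)) (by simp; omega)).2 hb
  · refine ⟨⟨?_, ?_⟩, cft_face_ext (by simp; omega)⟩
    · exact (cft_mem_blowup_iff_of_coords (faceVertex (u, 1) 2) (by simp; omega)).not.2 ha
    · exact (cft_mem_blowup_iff_of_coords (faceVertex (u, 1) (2 + 1)) (by simp; omega)).2 hb

/-- **Long turn: on around the corner.** If the vertices `k` and `k + 1` (`a` and `b`) of the
down face `G = (u, 1)` are both closed, the corner face at `c` of the big down-triangle between
`T(a)` and `T(b)` has exit side `k`, into the corner face `(b + u + (1,1), 0)` of `T(b)` at `c`: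
the fine interface keeps turning anticlockwise about the open corner `c`. -/
theorem cft_down_long_exit {τ : SiteConfig (Site 2)} {G : HexVertex} (hG : G.2 = 1) {k : Fin 3}
    (ha : faceVertex G k ∉ τ) (hb : faceVertex G (k + 1) ∉ τ) :
    IsExitSide {v : Site 2 | (∀ j, (2 : ℤ) ∣ v j) ∨ (fun j => v j / 2) ∈ τ}
        (oppFace ((fun j => faceVertex G k j + G.1 j + 1 : Site 2), (0 : Fin 2)) k) k ∧
      oppFace (oppFace ((fun j => faceVertex G k j + G.1 j + 1 : Site 2), (0 : Fin 2)) k) k =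
        ((fun j => faceVertex G (k + 1) j + G.1 j + 1 : Site 2), (0 : Fin 2)) := by
  obtain ⟨u, a⟩ := G
  simp only at hG
  subst hG
  fin_cases k
  · refine ⟨⟨?_, ?_⟩, cft_face_ext (by simp; omega)⟩
    · exact (cft_mem_blowup_iff_of_coords (faceVertex (u, 1) (0 + 1)) (by simp; omega)).not.2 hb
    · exact cft_mem_blowup_of_even (u 0 + 1) (u 1 + 1) (by simp; omega)
  · refine ⟨⟨?_, ?_⟩, cft_face_ext (by simp; omega)⟩
    · exact (cft_mem_blowup_iff_of_coords (faceVertex (u, 1) (1 + 1)) (by simp; omega)).not.2 hb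
    · exact cft_mem_blowup_of_even (u 0 + 1) (u 1 + 1) (by simp; omega)
  · refine ⟨⟨?_, ?_⟩, cft_face_ext (by simp; omega)⟩
    · exact (cft_mem_blowup_iff_of_coords (faceVertex (u, 1) (2 + 1)) (by simp; omega)).not.2 hb
    · exact cft_mem_blowup_of_even (u 0 + 1) (u 1 + 1) (by simp; omega)

/-- **Two fine steps shadowing a short turn** of the coarse interface at a down face `G = (u,1)`
(entered with closed vertex `a` = vertex `k`, next vertex `k + 1` open, so that it leaves across
the side `k + 2`): corner face of `T(a)` at `c` → corner face of the next big down-triangle →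
its middle face, the blow-up of the coarse up face `oppFace G (k + 2)`. -/
theorem cft_down_short_chain {τ : SiteConfig (Site 2)} {G : HexVertex} (hG : G.2 = 1) {k : Fin 3}
    (ha : faceVertex G k ∉ τ) (hb : faceVertex G (k + 1) ∈ τ) :
    ifaceSucc {v : Site 2 | (∀ j, (2 : ℤ) ∣ v j) ∨ (fun j => v j / 2) ∈ τ}
        ((fun j => faceVertex G k j + G.1 j + 1 : Site 2), (0 : Fin 2)) =
        some (oppFace ((fun j => faceVertex G k j + G.1 j + 1 : Site 2), (0 : Fin 2)) k) ∧
      ifaceSucc {v : Site 2 | (∀ j, (2 : ℤ) ∣ v j) ∨ (fun j => v j / 2) ∈ τ}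
        (oppFace ((fun j => faceVertex G k j + G.1 j + 1 : Site 2), (0 : Fin 2)) k) =
        some ((fun j => (oppFace G (k + 2)).1 j + (oppFace G (k + 2)).1 j + 1 : Site 2), (0 : Fin 2)) := by
  obtain ⟨h1, h2⟩ := cft_down_short_exit hG ha hb
  exact ⟨ifaceSucc_eq_some (cft_down_exit hG ha), by rw [ifaceSucc_eq_some h1, h2]⟩

/-- **Four fine steps shadowing a long turn** of the coarse interface at a down face `G = (u,1)`
(entered with closed vertex `a` = vertex `k`, next vertex `b` = vertex `k + 1` closed as well,
vertex `k + 2` open, so that it leaves across the side `k`): corner face of `T(a)` → corner face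
of the big down-triangle between `T(a), T(b)` → corner face of `T(b)` → corner face of the big
down-triangle after `T(b)` → its middle face, the blow-up of the coarse up face `oppFace G k`. -/
theorem cft_down_long_chain {τ : SiteConfig (Site 2)} {G : HexVertex} (hG : G.2 = 1) {k : Fin 3}
    (ha : faceVertex G k ∉ τ) (hb : faceVertex G (k + 1) ∉ τ) (hc : faceVertex G (k + 2) ∈ τ) :
    ifaceSucc {v : Site 2 | (∀ j, (2 : ℤ) ∣ v j) ∨ (fun j => v j / 2) ∈ τ}
        ((fun j => faceVertex G k j + G.1 j + 1 : Site 2), (0 : Fin 2)) =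
        some (oppFace ((fun j => faceVertex G k j + G.1 j + 1 : Site 2), (0 : Fin 2)) k) ∧
      ifaceSucc {v : Site 2 | (∀ j, (2 : ℤ) ∣ v j) ∨ (fun j => v j / 2) ∈ τ}
        (oppFace ((fun j => faceVertex G k j + G.1 j + 1 : Site 2), (0 : Fin 2)) k) =
        some ((fun j => faceVertex G (k + 1) j + G.1 j + 1 : Site 2), (0 : Fin 2)) ∧
      ifaceSucc {v : Site 2 | (∀ j, (2 : ℤ) ∣ v j) ∨ (fun j => v j / 2) ∈ τ}
        ((fun j => faceVertex G (k + 1) j + G.1 j + 1 : Site 2), (0 : Fin 2)) =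
        some (oppFace ((fun j => faceVertex G (k + 1) j + G.1 j + 1 : Site 2), (0 : Fin 2)) (k + 1)) ∧
      ifaceSucc {v : Site 2 | (∀ j, (2 : ℤ) ∣ v j) ∨ (fun j => v j / 2) ∈ τ}
        (oppFace ((fun j => faceVertex G (k + 1) j + G.1 j + 1 : Site 2), (0 : Fin 2)) (k + 1)) =
        some ((fun j => (oppFace G k).1 j + (oppFace G k).1 j + 1 : Site 2), (0 : Fin 2)) := by
  obtain ⟨h1, h2⟩ := cft_down_long_exit hG ha hb
  have hk : k + 1 + 1 = k + 2 := by rw [add_assoc]; rfl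
  have hk' : k + 1 + 2 = k := by
    rw [add_assoc, show (1 : Fin 3) + 2 = 0 from rfl, add_zero]
  obtain ⟨h3, h4⟩ := cft_down_short_chain (τ := τ) hG (k := k + 1) hb (by rw [hk]; exact hc)
  rw [hk'] at h4
  exact ⟨ifaceSucc_eq_some (cft_down_exit hG ha), by rw [ifaceSucc_eq_some h1, h2], h3, h4⟩

end Summit.CriticalPhenomena.CardyFormulaZ2.Cruxes.LoopLimitZ2EqT.HexSegment

end
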